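import Literature.InformationTheory.QuantumCodes.SpherePackingConverse
import Literature.InformationTheory.QuantumCodes.PathCountingBound
import Literature.InformationTheory.QuantumCodes.CSSThresholdConverses
import Literature.InformationTheory.QuantumCodes.IrreducibleClusters
import HarnessLib

/-!
# The distance FLOOR on logical failure: every decoder of a CSS sector with a weight-`w` logical fails with
# probability `≥ ½·C(w,⌈w/2⌉)·p^{⌈w/2⌉}(1−p)^{⌊w/2⌋}`; a positive code-capacity threshold forces `d → ∞`

Topic `Literature/InformationTheory/QuantumCodes` (venture QEC, LADDER-QEC rungs Q4/Q5; qec-lit-2 gen 6). Theorem-only;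
no definition, no named fact, no `sorry`.

**Printed statements.** Dennis–Kitaev–Landahl–Preskill 2002, §3: "The distance `d` of a stabilizer code is the
weight of the minimal-weight Pauli operator that preserves the code subspace and acts nontrivially … In principle,
`L/2` errors could suffice to cause damage to the encoded information"; §4.3: recovery succeeds iff the net chain
`E + E'` is homologically trivial (a stabilizer), and "`p` lies below the accuracy threshold" iff the failure
probability vanishes as `L → ∞`. Gottesman 1997, §2.3: "to correct `t` arbitrary errors, a code must have distance at
least `2t+1`". The tree already has the ADVERSARIAL form (`SyndromeDecodingCSSPauli.lean` / `OptimalRadius.lean`: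
no decoder corrects every error of weight `⌊(d−1)/2⌋ + 1`). This file is the PROBABILISTIC form under independent
flips — the two-hypothesis (pairing) bound — and its consequence for code families:

* `CSSCode.not_corrects_add_of_corrects` — a decoder of the `X`-syndrome cannot correct both `e` and `e + L` for a
  `Z`-logical `L` (`H^X L = 0`, `L ∉ rs H^Z`): same syndrome, the two net operations differ by `L`;
* `CSSCode.sum_halfOverlap_le_two_mul_zFailure` — for `0 ≤ p ≤ 1/2` and every decoder `D`:
  `P_p[2·|e ∩ supp L| ≥ |supp L|] ≤ 2·P_p[D fails]` (pair `e ↔ e + L`; on the half-overlap event `e + L` is no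
  heavier than `e`, so `prob(e) ≤ prob(e + L)`);
* `sum_halfOverlap_eq` (and private binomial helpers) — that event has probability
  `Σ_{2j ≥ w} C(w,j) p^j (1−p)^{w−j} ≥ C(w,⌈w/2⌉) p^{⌈w/2⌉} (1−p)^{⌊w/2⌋}`, `w = |supp L|`;
* **`CSSCode.distanceFloor_le_zFailure`** (`k ≥ 1`): `½·C(d^Z,⌈d^Z/2⌉)·p^{⌈d^Z/2⌉}(1−p)^{⌊d^Z/2⌋} ≤ P^Z_p[D fails]`
  for EVERY decoder (optimal / maximum-likelihood included: `distanceFloor_le_zOptimalFailure`); cruder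
  `½·p^{d^Z} ≤ P^Z_p[D fails]` (`half_pow_dZ_le_zFailure`); erasures: `y^{d^Z} ≤ P^Z_y[uncorrectable]`
  (`pow_dZ_le_zUncorrectableProb`); `X`-sector twins by the `X ↔ Z` exchange;
* FAMILIES (`k_i ≥ 1`, any decoder families): bounded `d^Z` ⇒ no flip rate `0 < p ≤ 1/2` is below threshold and the
  code-capacity accuracy threshold is `0` (`zFailure_accuracyThreshold_eq_zero_of_dZ_le`); conversely
  **`tendsto_dZ_atTop_of_belowThreshold`**: one below-threshold rate `0 < p ≤ 1/2` for SOME decoder family forces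
  `d^Z_i → ∞` (and `d^X_i → ∞` for the `X`-sector).

Census reading (Q4/Q5 honesty): next to every certified distance `d` the row carries a certified FLOOR on the logical
error rate of any decoder, e.g. `d = 12`, `p = 10⁻³`: `P_fail ≥ ½·924·10⁻¹⁸·0.999⁶` per sector — the counterpart of
the cluster-expansion CEILINGS of `CSSFiniteSizeBounds.lean`. Not claimed: anything sharper than the pairing bound
(the true leading order counts all uncorrectable weight-`⌈d/2⌉` patterns, decoder-dependent), depolarizing
correlations, numerics.

## References

* [DennisEtAl2002] E. Dennis, A. Kitaev, A. Landahl, J. Preskill, *Topological quantum memory*, J. Math. Phys. 43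
  (2002) 4452 = arXiv:quant-ph/0110143, §3 (chunk p0008 L5: distance; chunk p0010 L3: "L/2 errors could suffice to
  cause damage"), §4.3 (success iff `E + E'` trivial; below threshold), §4.6 (`p_c`).
* [Gottesman1997] D. Gottesman, PhD thesis, arXiv:quant-ph/9705052, §2.3 ("to correct t errors … distance ≥ 2t+1").
* [LinCostello2004] S. Lin, D. J. Costello, *Error Control Coding*, 2nd ed., §3.5 (smaller weight is more probable
  for `p ≤ 1/2`).

## Mathlib / tree search

Tree: `Decoder.Corrects` (`SyndromeDecoding`), `CSSCode.zSyndrome/xSyndrome/rowSpZ/rowSpX/dZ/dX`,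
`CSSCode.exists_hammingNorm_eq_dZ`, `dZ_pos_iff`, `dZ_pos_of_k_pos`, `bernoulliWeight`, `pow_mul_pow_le_of_le`
(`SpherePackingConverse`), `sum_bernoulliWeight_filter_inter` (`PathCountingBound`), `sum_bernoulliWeight_filter_superset`,
`vecOf`/`supp_vecOf`/`vecOf_supp` (`IrreducibleClusters`), `not_belowThreshold_of_le`, `accuracyThreshold_nonneg`,
`belowThreshold_of_lt_accuracyThreshold`, `CSSCode.exists_zFailure_eq_zOptimalFailure`. Mathlib: `Finset.sum_nbij'`,
`Fintype.sum_equiv`, `Equiv.addRight`, `Finset.card_powersetCard`, `Finset.card_sdiff_add_card_inter`,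
`Filter.tendsto_atTop`.
-/

namespace Literature.InformationTheory.QuantumCodes

open Finset Matrix Filter Topology

/-! ### Supports under addition over `𝔽₂` -/

section Supp

variable {V : Type*} [Fintype V] [DecidableEq V]

/-- `supp (e + L) = (supp e ∖ supp L) ∪ (supp L ∖ supp e)` over `𝔽₂`. [folklore] -/
private theorem supp_add_eq_sdiff_union_sdiff (e L : V → ZMod 2) :
    supp (e + L) = (supp e \ supp L) ∪ (supp L \ supp e) := by
  have hmem : ∀ (x : V → ZMod 2) (v : V), v ∈ supp x ↔ x v ≠ 0 := fun x v => by simp [supp]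
  have key : ∀ a b : ZMod 2, (a + b ≠ 0 ↔ (a ≠ 0 ∧ ¬ b ≠ 0) ∨ (b ≠ 0 ∧ ¬ a ≠ 0)) := by decide
  ext v
  simp only [Finset.mem_union, Finset.mem_sdiff, hmem, Pi.add_apply]
  exact key (e v) (L v)

/-- `|supp (e + L)| + 2|supp L ∩ supp e| = |supp e| + |supp L|`. [folklore] -/
private theorem card_supp_add (e L : V → ZMod 2) :
    (supp (e + L)).card + 2 * (supp L ∩ supp e).card = (supp e).card + (supp L).card := by
  rw [supp_add_eq_sdiff_union_sdiff]
  have hdisj : Disjoint (supp e \ supp L) (supp L \ supp e) :=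
    disjoint_left.2 fun v hv hv' => (mem_sdiff.1 hv').2 (mem_sdiff.1 hv).1
  rw [card_union_of_disjoint hdisj]
  have h1 := card_sdiff_add_card_inter (supp e) (supp L)
  have h2 := card_sdiff_add_card_inter (supp L) (supp e)
  rw [inter_comm] at h1
  omega

/-- On the half-overlap event `2|supp L ∩ supp e| ≥ |supp L|` the flipped pattern `e + L` is no heavier, hence no
less probable for `0 ≤ p ≤ 1/2`. [cite: LinCostello2004, §3.5 (smaller weight is more probable for p ≤ 1/2)] -/
theorem bernoulliWeight_supp_le_supp_add {p : ℝ} (hp0 : 0 ≤ p) (hp : p ≤ 1 / 2) {e L : V → ZMod 2}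
    (h : (supp L).card ≤ 2 * (supp L ∩ supp e).card) :
    bernoulliWeight p (supp e) ≤ bernoulliWeight p (supp (e + L)) := by
  have hc := card_supp_add e L
  have hle : (supp (e + L)).card ≤ (supp e).card := by omega
  unfold bernoulliWeight
  exact pow_mul_pow_le_of_le hp0 hp hle (card_le_univ _)

/-- The half-overlap event through the bijection `e ↦ supp e`: `P_p[2|T ∩ supp e| ≥ |T|]` is the binomial tail
`Σ_{B ⊆ T, 2|B| ≥ |T|} p^{|B|}(1-p)^{|T|-|B|}`. [cite: DennisEtAl2002, §5.2 (probability that given links have errors)] -/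
theorem sum_halfOverlap_eq (p : ℝ) (T : Finset V) :
    ∑ e ∈ univ.filter (fun e : V → ZMod 2 => T.card ≤ 2 * (T ∩ supp e).card), bernoulliWeight p (supp e) =
      ∑ B ∈ T.powerset.filter (fun B => T.card ≤ 2 * B.card), p ^ B.card * (1 - p) ^ (T.card - B.card) := by
  rw [← sum_bernoulliWeight_filter_inter p T (fun B => T.card ≤ 2 * B.card)]
  refine sum_nbij' supp vecOf (fun e he => ?_) (fun E hE => ?_) (fun e _ => vecOf_supp e) (fun E _ => supp_vecOf E)
    (fun e _ => rfl)
  · rw [mem_filter] at he ⊢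
    exact ⟨mem_univ _, he.2⟩
  · rw [mem_filter] at hE ⊢
    rw [supp_vecOf]
    exact ⟨mem_univ _, hE.2⟩

omit [Fintype V] [DecidableEq V] in
/-- The central binomial term bounds the tail from below: `C(w,⌈w/2⌉) p^{⌈w/2⌉}(1-p)^{⌊w/2⌋} ≤ Σ_{2|B| ≥ w} …`
(`w = |T|`, `0 ≤ p ≤ 1`). [folklore] -/
private theorem choose_mul_pow_le_sum_halfOverlap {p : ℝ} (hp0 : 0 ≤ p) (hp1 : p ≤ 1) (T : Finset V) :
    (T.card.choose ((T.card + 1) / 2) : ℝ) * (p ^ ((T.card + 1) / 2) * (1 - p) ^ (T.card / 2)) ≤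
      ∑ B ∈ T.powerset.filter (fun B => T.card ≤ 2 * B.card), p ^ B.card * (1 - p) ^ (T.card - B.card) := by
  set m := (T.card + 1) / 2 with hm
  have hcm : T.card - m = T.card / 2 := by omega
  have hsub : T.powersetCard m ⊆ T.powerset.filter (fun B => T.card ≤ 2 * B.card) := by
    intro B hB
    rw [mem_powersetCard] at hB
    rw [mem_filter, mem_powerset]
    exact ⟨hB.1, by omega⟩
  rw [← hcm]
  calc (T.card.choose m : ℝ) * (p ^ m * (1 - p) ^ (T.card - m))
      = ∑ _B ∈ T.powersetCard m, p ^ m * (1 - p) ^ (T.card - m) := by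
        rw [sum_const, card_powersetCard, nsmul_eq_mul]
    _ = ∑ B ∈ T.powersetCard m, p ^ B.card * (1 - p) ^ (T.card - B.card) :=
        sum_congr rfl fun B hB => by rw [(mem_powersetCard.1 hB).2]
    _ ≤ _ := sum_le_sum_of_subset_of_nonneg hsub fun B _ _ =>
        mul_nonneg (pow_nonneg hp0 _) (pow_nonneg (by linarith) _)

/-- The central term alone: `p^{w} ≤ C(w,⌈w/2⌉) p^{⌈w/2⌉}(1-p)^{⌊w/2⌋}` for `0 ≤ p ≤ 1/2` (`1 - p ≥ p`,
`C(w,⌈w/2⌉) ≥ 1`). [folklore] -/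
private theorem pow_le_choose_half_mul_pow {p : ℝ} (hp0 : 0 ≤ p) (hp : p ≤ 1 / 2) (w : ℕ) :
    p ^ w ≤ (w.choose ((w + 1) / 2) : ℝ) * (p ^ ((w + 1) / 2) * (1 - p) ^ (w / 2)) := by
  have h1 : (1 : ℝ) ≤ (w.choose ((w + 1) / 2) : ℝ) := by
    exact_mod_cast Nat.choose_pos (by omega : (w + 1) / 2 ≤ w)
  have h2 : p ^ (w / 2) ≤ (1 - p) ^ (w / 2) := pow_le_pow_left₀ hp0 (by linarith) _
  have h3 : p ^ w = p ^ ((w + 1) / 2) * p ^ (w / 2) := by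
    rw [← pow_add]; congr 1; omega
  rw [h3]
  have h4 : p ^ ((w + 1) / 2) * p ^ (w / 2) ≤ p ^ ((w + 1) / 2) * (1 - p) ^ (w / 2) :=
    mul_le_mul_of_nonneg_left h2 (pow_nonneg hp0 _)
  have h5 : 0 ≤ p ^ ((w + 1) / 2) * (1 - p) ^ (w / 2) := mul_nonneg (pow_nonneg hp0 _) (pow_nonneg (by linarith) _)
  nlinarith

end Supp

/-! ### One CSS code, one sector: the pairing bound -/

namespace CSSCode

variable {RX RZ V : Type*} [Fintype V] [DecidableEq V] [Fintype RZ]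

omit [DecidableEq V] in
/-- **Pairing.** A decoder of the `X`-syndrome cannot correct both `e` and `e + L` when `L` is a `Z`-logical
(`H^X L = 0`, `L ∉ rs H^Z`): the two patterns have the same syndrome and the two net operations differ by `L`.
[cite: DennisEtAl2002, §4.3 (recovery succeeds iff E + E' is homologically trivial); Gottesman1997, §2.3] -/
theorem not_corrects_add_of_corrects (C : CSSCode RX RZ V) (D : Decoder (RX → ZMod 2) (V → ZMod 2))
    {L : V → ZMod 2} (hL : C.HX *ᵥ L = 0) (hL' : L ∉ C.rowSpZ) {e : V → ZMod 2}
    (he : D.Corrects C.zSyndrome (C.rowSpZ : Set (V → ZMod 2)) e) :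
    ¬ D.Corrects C.zSyndrome (C.rowSpZ : Set (V → ZMod 2)) (e + L) := by
  intro he'
  rw [Decoder.corrects_iff] at he he'
  have hsyn : C.zSyndrome (e + L) = C.zSyndrome e := by
    show C.HX *ᵥ (e + L) = C.HX *ᵥ e
    rw [Matrix.mulVec_add, hL, add_zero]
  rw [hsyn] at he'
  have hmem : (D (C.zSyndrome e) + (e + L)) - (D (C.zSyndrome e) + e) ∈ C.rowSpZ := C.rowSpZ.sub_mem he' he
  have hL2 : (D (C.zSyndrome e) + (e + L)) - (D (C.zSyndrome e) + e) = L := by abel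
  rw [hL2] at hmem
  exact hL' hmem

open Classical in
/-- **The two-hypothesis bound.** For every decoder `D` of the `X`-syndrome, every `Z`-logical `L` and independent
flips of rate `0 ≤ p ≤ 1/2`: `P_p[2|supp L ∩ supp e| ≥ |supp L|] ≤ 2 · P_p[D fails]` (pair `e ↔ e + L`: one of the
two fails, and on the half-overlap event `e + L` is no less probable than `e`).
[cite: DennisEtAl2002, §3 (chunk p0010 L3: "L/2 errors could suffice to cause damage") and §4.3] -/
theorem sum_halfOverlap_le_two_mul_zFailure (C : CSSCode RX RZ V) (D : Decoder (RX → ZMod 2) (V → ZMod 2))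
    {L : V → ZMod 2} (hL : C.HX *ᵥ L = 0) (hL' : L ∉ C.rowSpZ) {p : ℝ} (hp0 : 0 ≤ p) (hp : p ≤ 1 / 2) :
    ∑ e ∈ univ.filter (fun e : V → ZMod 2 => (supp L).card ≤ 2 * (supp L ∩ supp e).card),
        bernoulliWeight p (supp e) ≤
      2 * ∑ e ∈ univ.filter (fun e : V → ZMod 2 =>
        ¬ D.Corrects C.zSyndrome (C.rowSpZ : Set (V → ZMod 2)) e), bernoulliWeight p (supp e) := by
  set w : (V → ZMod 2) → ℝ := fun e => bernoulliWeight p (supp e) with hw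
  have hw0 : ∀ e, 0 ≤ w e := fun e => bernoulliWeight_nonneg hp0 (by linarith) _
  have hpt : ∀ e : V → ZMod 2,
      (if (supp L).card ≤ 2 * (supp L ∩ supp e).card then w e else 0) ≤
        (if ¬ D.Corrects C.zSyndrome (C.rowSpZ : Set (V → ZMod 2)) e then w e else 0) +
          (if ¬ D.Corrects C.zSyndrome (C.rowSpZ : Set (V → ZMod 2)) (e + L) then w (e + L) else 0) := by
    intro e
    have h1 : 0 ≤ (if ¬ D.Corrects C.zSyndrome (C.rowSpZ : Set (V → ZMod 2)) e then w e else 0) := by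
      split_ifs <;> first | exact hw0 _ | exact le_rfl
    have h2 : 0 ≤ (if ¬ D.Corrects C.zSyndrome (C.rowSpZ : Set (V → ZMod 2)) (e + L) then w (e + L) else 0) := by
      split_ifs <;> first | exact hw0 _ | exact le_rfl
    by_cases hA : (supp L).card ≤ 2 * (supp L ∩ supp e).card
    · rw [if_pos hA]
      have hwle : w e ≤ w (e + L) := bernoulliWeight_supp_le_supp_add hp0 hp hA
      by_cases hc : D.Corrects C.zSyndrome (C.rowSpZ : Set (V → ZMod 2)) e
      · have hc' := C.not_corrects_add_of_corrects D hL hL' hc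
        rw [if_pos hc'] 
        linarith
      · rw [if_pos hc]
        linarith
    · rw [if_neg hA]
      linarith
  have hsum := sum_le_sum fun e (_ : e ∈ (univ : Finset (V → ZMod 2))) => hpt e
  rw [← sum_filter, sum_add_distrib, ← sum_filter] at hsum
  have hshift : ∑ e : V → ZMod 2,
      (if ¬ D.Corrects C.zSyndrome (C.rowSpZ : Set (V → ZMod 2)) (e + L) then w (e + L) else 0) =
      ∑ e : V → ZMod 2, (if ¬ D.Corrects C.zSyndrome (C.rowSpZ : Set (V → ZMod 2)) e then w e else 0) :=
    Fintype.sum_equiv (Equiv.addRight L) _ _ fun e => rfl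
  rw [hshift, ← sum_filter] at hsum
  linarith

open Classical in
/-- **Every decoder fails with probability `≥ ½·C(w,⌈w/2⌉)·p^{⌈w/2⌉}(1−p)^{⌊w/2⌋}`** when the sector has a logical
of weight `w` (`0 ≤ p ≤ 1/2`). [cite: DennisEtAl2002, §3 (chunk p0010 L3) and §4.3] -/
theorem choose_mul_pow_le_zFailure (C : CSSCode RX RZ V) (D : Decoder (RX → ZMod 2) (V → ZMod 2))
    {L : V → ZMod 2} (hL : C.HX *ᵥ L = 0) (hL' : L ∉ C.rowSpZ) {p : ℝ} (hp0 : 0 ≤ p) (hp : p ≤ 1 / 2) :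
    1 / 2 * (((supp L).card.choose (((supp L).card + 1) / 2) : ℝ) *
        (p ^ (((supp L).card + 1) / 2) * (1 - p) ^ ((supp L).card / 2))) ≤
      ∑ e ∈ univ.filter (fun e : V → ZMod 2 =>
        ¬ D.Corrects C.zSyndrome (C.rowSpZ : Set (V → ZMod 2)) e), bernoulliWeight p (supp e) := by
  have h1 := C.sum_halfOverlap_le_two_mul_zFailure D hL hL' hp0 hp
  rw [sum_halfOverlap_eq] at h1
  have h2 := choose_mul_pow_le_sum_halfOverlap hp0 (by linarith) (supp L)
  linarith

open Classical in
/-- **THE DISTANCE FLOOR (`Z`-sector).** For a CSS code with `k ≥ 1`, EVERY decoder of the `X`-syndrome and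
independent phase flips of rate `0 ≤ p ≤ 1/2`:
`½·C(d^Z,⌈d^Z/2⌉)·p^{⌈d^Z/2⌉}(1−p)^{⌊d^Z/2⌋} ≤ P^Z_p[D fails]` — "`L/2` errors could suffice to cause damage".
[cite: DennisEtAl2002, §3 (chunk p0008 L5, p0010 L3) and §4.3; Gottesman1997, §2.3] -/
theorem distanceFloor_le_zFailure [Fintype RX] (C : CSSCode RX RZ V) (hk : 0 < C.k) (D : Decoder (RX → ZMod 2) (V → ZMod 2))
    {p : ℝ} (hp0 : 0 ≤ p) (hp : p ≤ 1 / 2) :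
    1 / 2 * ((C.dZ.choose ((C.dZ + 1) / 2) : ℝ) * (p ^ ((C.dZ + 1) / 2) * (1 - p) ^ (C.dZ / 2))) ≤
      ∑ e ∈ univ.filter (fun e : V → ZMod 2 =>
        ¬ D.Corrects C.zSyndrome (C.rowSpZ : Set (V → ZMod 2)) e), bernoulliWeight p (supp e) := by
  obtain ⟨L, hL, hL', hLd⟩ := C.exists_hammingNorm_eq_dZ (C.dZ_pos_iff.1 (C.dZ_pos_of_k_pos hk))
  have h := C.choose_mul_pow_le_zFailure D hL hL' hp0 hp
  have hc : (supp L).card = C.dZ := hLd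
  rw [hc] at h
  exact h

open Classical in
/-- Cruder: `½·p^{d^Z} ≤ P^Z_p[D fails]` for every decoder (`k ≥ 1`, `0 ≤ p ≤ 1/2`).
[cite: DennisEtAl2002, §3 (chunk p0010 L3) and §4.3] -/
theorem half_pow_dZ_le_zFailure [Fintype RX] (C : CSSCode RX RZ V) (hk : 0 < C.k) (D : Decoder (RX → ZMod 2) (V → ZMod 2))
    {p : ℝ} (hp0 : 0 ≤ p) (hp : p ≤ 1 / 2) :
    1 / 2 * p ^ C.dZ ≤
      ∑ e ∈ univ.filter (fun e : V → ZMod 2 =>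
        ¬ D.Corrects C.zSyndrome (C.rowSpZ : Set (V → ZMod 2)) e), bernoulliWeight p (supp e) := by
  have h1 := C.distanceFloor_le_zFailure hk D hp0 hp
  have h2 := pow_le_choose_half_mul_pow hp0 hp C.dZ
  linarith

open Classical in
/-- The floor holds for the OPTIMAL (maximum-likelihood) decoder: `½·C(d^Z,⌈d^Z/2⌉)·p^{⌈d^Z/2⌉}(1−p)^{⌊d^Z/2⌋} ≤
zOptimalFailure C p`. [cite: DennisEtAl2002, §4.3 (the optimal way to recover) and §3 (chunk p0010 L3)] -/
theorem distanceFloor_le_zOptimalFailure [Fintype RX] (C : CSSCode RX RZ V) (hk : 0 < C.k) {p : ℝ} (hp0 : 0 ≤ p)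
    (hp : p ≤ 1 / 2) :
    1 / 2 * ((C.dZ.choose ((C.dZ + 1) / 2) : ℝ) * (p ^ ((C.dZ + 1) / 2) * (1 - p) ^ (C.dZ / 2))) ≤
      C.zOptimalFailure p := by
  obtain ⟨D, _, hD⟩ := C.exists_zFailure_eq_zOptimalFailure p
  rw [← hD]
  exact C.distanceFloor_le_zFailure hk D hp0 hp

/-- **Erasure floor**: erasing the support of a minimum-weight `Z`-logical is uncorrectable, so
`y^{d^Z} ≤ P^Z_y[erasure uncorrectable]` (`k ≥ 1`, `0 ≤ y ≤ 1`; every erasure decoder fails at least this often,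
`ErasureDecoder.uncorrectableProb_le_failureProb`). [cite: DelfosseZemor2020, §2 (failure iff a logical operator L ⊂ ℰ); Gottesman1997, §2.3 (located errors need distance r+1)] -/
theorem pow_dZ_le_zUncorrectableProb [Fintype RX] (C : CSSCode RX RZ V) (hk : 0 < C.k) {y : ℝ} (hy0 : 0 ≤ y) (hy1 : y ≤ 1) :
    y ^ C.dZ ≤
      ErasureDecoder.uncorrectableProb {x : V → ZMod 2 | C.HX *ᵥ x = 0} (C.rowSpZ : Set (V → ZMod 2)) y := by
  classical
  obtain ⟨L, hL, hL', hLd⟩ := C.exists_hammingNorm_eq_dZ (C.dZ_pos_iff.1 (C.dZ_pos_of_k_pos hk))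
  rw [ErasureDecoder.uncorrectableProb_eq_sum, show C.dZ = (supp L).card from hLd.symm,
    ← sum_bernoulliWeight_filter_superset y (supp L)]
  refine sum_le_sum_of_subset_of_nonneg (fun E hE => ?_) fun E _ _ => bernoulliWeight_nonneg hy0 hy1 E
  rw [mem_filter] at hE ⊢
  exact ⟨mem_univ _, fun hcorr => hL' (hcorr L hL hE.2)⟩

/-! ### `X`-sector twins (the `X ↔ Z` exchange `CSSCode.swap`) -/

open Classical in
/-- **THE DISTANCE FLOOR (`X`-sector)**: `½·C(d^X,⌈d^X/2⌉)·p^{⌈d^X/2⌉}(1−p)^{⌊d^X/2⌋} ≤ P^X_p[D fails]` for every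
decoder of the `Z`-syndrome (bit flips, success modulo `rs H^X`; `k ≥ 1`, `0 ≤ p ≤ 1/2`).
[cite: DennisEtAl2002, §3 (chunk p0010 L3) and §4.3; Gottesman1997, §2.3] -/
theorem distanceFloor_le_xFailure [Fintype RX] (C : CSSCode RX RZ V) (hk : 0 < C.k)
    (D : Decoder (RZ → ZMod 2) (V → ZMod 2)) {p : ℝ} (hp0 : 0 ≤ p) (hp : p ≤ 1 / 2) :
    1 / 2 * ((C.dX.choose ((C.dX + 1) / 2) : ℝ) * (p ^ ((C.dX + 1) / 2) * (1 - p) ^ (C.dX / 2))) ≤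
      ∑ e ∈ univ.filter (fun e : V → ZMod 2 =>
        ¬ D.Corrects C.xSyndrome (C.rowSpX : Set (V → ZMod 2)) e), bernoulliWeight p (supp e) := by
  have h := C.swap.distanceFloor_le_zFailure (by rw [CSSCode.k_swap]; exact hk) D hp0 hp
  rw [CSSCode.dZ_swap] at h
  exact h

open Classical in
/-- `½·p^{d^X} ≤ P^X_p[D fails]` for every decoder (`k ≥ 1`, `0 ≤ p ≤ 1/2`). [cite: DennisEtAl2002, §3 (chunk p0010 L3) and §4.3] -/
theorem half_pow_dX_le_xFailure [Fintype RX] (C : CSSCode RX RZ V) (hk : 0 < C.k)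
    (D : Decoder (RZ → ZMod 2) (V → ZMod 2)) {p : ℝ} (hp0 : 0 ≤ p) (hp : p ≤ 1 / 2) :
    1 / 2 * p ^ C.dX ≤
      ∑ e ∈ univ.filter (fun e : V → ZMod 2 =>
        ¬ D.Corrects C.xSyndrome (C.rowSpX : Set (V → ZMod 2)) e), bernoulliWeight p (supp e) := by
  have h := C.swap.half_pow_dZ_le_zFailure (by rw [CSSCode.k_swap]; exact hk) D hp0 hp
  rw [CSSCode.dZ_swap] at h
  exact h

/-- The `X`-floor for the optimal decoder: `½·C(d^X,⌈d^X/2⌉)·p^{⌈d^X/2⌉}(1−p)^{⌊d^X/2⌋} ≤ xOptimalFailure C p`.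
[cite: DennisEtAl2002, §4.3 (the optimal way to recover) and §3 (chunk p0010 L3)] -/
theorem distanceFloor_le_xOptimalFailure [Fintype RX] (C : CSSCode RX RZ V) (hk : 0 < C.k) {p : ℝ} (hp0 : 0 ≤ p)
    (hp : p ≤ 1 / 2) :
    1 / 2 * ((C.dX.choose ((C.dX + 1) / 2) : ℝ) * (p ^ ((C.dX + 1) / 2) * (1 - p) ^ (C.dX / 2))) ≤
      C.xOptimalFailure p := by
  have h := C.swap.distanceFloor_le_zOptimalFailure (by rw [CSSCode.k_swap]; exact hk) hp0 hp
  rw [CSSCode.dZ_swap] at h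
  rw [CSSCode.xOptimalFailure_eq_swap]
  exact h

/-- **Erasure floor (`X`-sector)**: `y^{d^X} ≤ P^X_y[erasure uncorrectable]` (`k ≥ 1`, `0 ≤ y ≤ 1`).
[cite: DelfosseZemor2020, §2 (failure iff a logical operator L ⊂ ℰ); Gottesman1997, §2.3] -/
theorem pow_dX_le_xUncorrectableProb [Fintype RX] (C : CSSCode RX RZ V) (hk : 0 < C.k) {y : ℝ} (hy0 : 0 ≤ y)
    (hy1 : y ≤ 1) :
    y ^ C.dX ≤
      ErasureDecoder.uncorrectableProb {x : V → ZMod 2 | C.HZ *ᵥ x = 0} (C.rowSpX : Set (V → ZMod 2)) y := by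
  have h := C.swap.pow_dZ_le_zUncorrectableProb (by rw [CSSCode.k_swap]; exact hk) hy0 hy1
  rw [CSSCode.dZ_swap] at h
  exact h

end CSSCode

/-! ### Families: bounded distance means threshold `0`; a threshold forces `d → ∞` -/

section Families

/-- If no rate `0 < p ≤ 1/2` is below threshold, the accuracy threshold is `0`.
[cite: DennisEtAl2002, §4.3 (below threshold) and §4.6 (p_c)] -/
theorem accuracyThreshold_eq_zero_of_not_belowThreshold {P : ℕ → ℝ → ℝ}
    (h : ∀ p : ℝ, 0 < p → p ≤ 1 / 2 → ¬ BelowThreshold P p) : accuracyThreshold P = 0 := by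
  refine le_antisymm ?_ (accuracyThreshold_nonneg _)
  by_contra hpos
  push Not at hpos
  set q : ℝ := min (accuracyThreshold P / 2) (1 / 2) with hq
  have hq0 : 0 < q := lt_min (by linarith) (by norm_num)
  have hqa : q < accuracyThreshold P := lt_of_le_of_lt (min_le_left _ _) (by linarith)
  exact h q hq0 (min_le_right _ _) (belowThreshold_of_lt_accuracyThreshold hq0.le hqa)

variable {RX RZ Q : ℕ → Type*} [∀ i, Fintype (Q i)] [∀ i, DecidableEq (Q i)] [∀ i, Fintype (RX i)]
  [∀ i, Fintype (RZ i)]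

open Classical in
/-- **Bounded distance ⇒ no code-capacity threshold, for ANY decoder family** (`Z`-sector): if `k_i ≥ 1` and
`d^Z_i ≤ w` for all `i`, no flip rate `0 < p ≤ 1/2` is below threshold (`P_fail ≥ ½ p^w` uniformly in `i`).
[cite: DennisEtAl2002, §4.3 (below threshold: the failure probability vanishes as L → ∞) and §3 (chunk p0010 L3)] -/
theorem not_belowThreshold_zFailure_of_dZ_le (C : ∀ i, CSSCode (RX i) (RZ i) (Q i)) (hk : ∀ i, 0 < (C i).k)
    (DZ : ∀ i, Decoder (RX i → ZMod 2) (Q i → ZMod 2)) {w : ℕ} (hw : ∀ i, (C i).dZ ≤ w) {p : ℝ} (hp0 : 0 < p)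
    (hp : p ≤ 1 / 2) :
    ¬ BelowThreshold (fun i p => ∑ e ∈ univ.filter (fun e : Q i → ZMod 2 =>
        ¬ (DZ i).Corrects (C i).zSyndrome ((C i).rowSpZ : Set (Q i → ZMod 2)) e), bernoulliWeight p (supp e)) p := by
  refine not_belowThreshold_of_le (c := 1 / 2 * p ^ w) (by positivity) fun i => ?_
  have h := (C i).half_pow_dZ_le_zFailure (hk i) (DZ i) hp0.le hp
  have hmono : p ^ w ≤ p ^ (C i).dZ := pow_le_pow_of_le_one hp0.le (by linarith) (hw i)
  linarith

open Classical in
/-- **Accuracy threshold `0`** for every decoder family of the `Z`-sector of a CSS family with `k_i ≥ 1` and bounded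
`Z`-distance. [cite: DennisEtAl2002, §4.6 (p_c) and §3 (chunk p0010 L3)] -/
theorem zFailure_accuracyThreshold_eq_zero_of_dZ_le (C : ∀ i, CSSCode (RX i) (RZ i) (Q i)) (hk : ∀ i, 0 < (C i).k)
    (DZ : ∀ i, Decoder (RX i → ZMod 2) (Q i → ZMod 2)) {w : ℕ} (hw : ∀ i, (C i).dZ ≤ w) :
    accuracyThreshold (fun i p => ∑ e ∈ univ.filter (fun e : Q i → ZMod 2 =>
        ¬ (DZ i).Corrects (C i).zSyndrome ((C i).rowSpZ : Set (Q i → ZMod 2)) e), bernoulliWeight p (supp e)) = 0 :=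
  accuracyThreshold_eq_zero_of_not_belowThreshold fun _ hp0 hp =>
    not_belowThreshold_zFailure_of_dZ_le C hk DZ hw hp0 hp

open Classical in
/-- **A CODE-CAPACITY THRESHOLD FORCES `d^Z → ∞`.** If `k_i ≥ 1` and SOME decoder family of the `Z`-sector is below
threshold at SOME flip rate `0 < p ≤ 1/2`, then `d^Z_i → ∞` (for every `w`, eventually `d^Z_i ≥ w`: otherwise
`P_fail ≥ ½ p^w` along a subsequence). [cite: DennisEtAl2002, §4.3 (below threshold) and §3 (chunk p0008 L5, p0010 L3)] -/
theorem tendsto_dZ_atTop_of_belowThreshold (C : ∀ i, CSSCode (RX i) (RZ i) (Q i)) (hk : ∀ i, 0 < (C i).k)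
    (DZ : ∀ i, Decoder (RX i → ZMod 2) (Q i → ZMod 2)) {p : ℝ} (hp0 : 0 < p) (hp : p ≤ 1 / 2)
    (h : BelowThreshold (fun i p => ∑ e ∈ univ.filter (fun e : Q i → ZMod 2 =>
        ¬ (DZ i).Corrects (C i).zSyndrome ((C i).rowSpZ : Set (Q i → ZMod 2)) e), bernoulliWeight p (supp e)) p) :
    Tendsto (fun i => (C i).dZ) atTop atTop := by
  unfold BelowThreshold at h
  rw [tendsto_atTop]
  intro w
  have hc : (0 : ℝ) < 1 / 2 * p ^ w := by positivity
  refine (h.eventually (gt_mem_nhds hc)).mono fun i hi => ?_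
  by_contra hlt
  push Not at hlt
  have h1 := (C i).half_pow_dZ_le_zFailure (hk i) (DZ i) hp0.le hp
  have hmono : p ^ w ≤ p ^ (C i).dZ := pow_le_pow_of_le_one hp0.le (by linarith) hlt.le
  have hi' : ∑ e ∈ univ.filter (fun e : Q i → ZMod 2 =>
      ¬ (DZ i).Corrects (C i).zSyndrome ((C i).rowSpZ : Set (Q i → ZMod 2)) e), bernoulliWeight p (supp e) <
        1 / 2 * p ^ w := hi
  linarith

open Classical in
/-- **A threshold forces `d^X → ∞`** (`X`-sector: some decoder family of the `Z`-syndrome below threshold at some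
`0 < p ≤ 1/2`, `k_i ≥ 1`). [cite: DennisEtAl2002, §4.3 and §3 (chunk p0010 L3)] -/
theorem tendsto_dX_atTop_of_belowThreshold (C : ∀ i, CSSCode (RX i) (RZ i) (Q i)) (hk : ∀ i, 0 < (C i).k)
    (DX : ∀ i, Decoder (RZ i → ZMod 2) (Q i → ZMod 2)) {p : ℝ} (hp0 : 0 < p) (hp : p ≤ 1 / 2)
    (h : BelowThreshold (fun i p => ∑ e ∈ univ.filter (fun e : Q i → ZMod 2 =>
        ¬ (DX i).Corrects (C i).xSyndrome ((C i).rowSpX : Set (Q i → ZMod 2)) e), bernoulliWeight p (supp e)) p) :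
    Tendsto (fun i => (C i).dX) atTop atTop := by
  have h' := tendsto_dZ_atTop_of_belowThreshold (fun i => (C i).swap) (fun i => by rw [CSSCode.k_swap]; exact hk i)
    DX hp0 hp h
  simpa only [CSSCode.dZ_swap] using h'

open Classical in
/-- `X`-sector: bounded `d^X` and `k_i ≥ 1` ⇒ accuracy threshold `0` for every decoder family of the `Z`-syndrome.
[cite: DennisEtAl2002, §4.6 (p_c) and §3 (chunk p0010 L3)] -/
theorem xFailure_accuracyThreshold_eq_zero_of_dX_le (C : ∀ i, CSSCode (RX i) (RZ i) (Q i)) (hk : ∀ i, 0 < (C i).k)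
    (DX : ∀ i, Decoder (RZ i → ZMod 2) (Q i → ZMod 2)) {w : ℕ} (hw : ∀ i, (C i).dX ≤ w) :
    accuracyThreshold (fun i p => ∑ e ∈ univ.filter (fun e : Q i → ZMod 2 =>
        ¬ (DX i).Corrects (C i).xSyndrome ((C i).rowSpX : Set (Q i → ZMod 2)) e), bernoulliWeight p (supp e)) = 0 :=
  zFailure_accuracyThreshold_eq_zero_of_dZ_le (fun i => (C i).swap) (fun i => by rw [CSSCode.k_swap]; exact hk i) DX
    (w := w) fun i => by rw [CSSCode.dZ_swap]; exact hw i

end Families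

end Literature.InformationTheory.QuantumCodes
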